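import Mathlib
import HarnessLib
import Summits.ResolutionOfSingularities.ResolutionOfSingularities.Theorems.WildConesNarrowRunsDieStubHomogNear

/-!
# Crux `NarrowRunsDie` (stmt-ResolutionOfSingularities-16882, route `WildCones`), line `derivlift` —
# stub `stub_homogTrans`

Registered stub of the line skeleton `Cruxes/NarrowRunsDie/Lines/derivlift.lean` (v3), stated over the
route's inlined `let` calculus VERBATIM. See the skeleton docstring of `Sig.stub_homogTrans` for the paper proof.

Proof outline (pure `MvPolynomial` bookkeeping, no characteristic-`p` input):
* `kill := aeval (X_i ↦ 0)` keeps exactly the coefficients `A` with `A i = 0` (`homogNear_coeff_kill`,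
  reused from the landed sister module `WildConesNarrowRunsDieStubHomogNear`);
* substituting `X none ↦ 1, X (some i) ↦ 0` in `hv` gives `g = kill G + C (G v)` (`homogTrans_g_eq`);
* with `hslice`, `hdiag` and homogeneity this yields `kill G' = kill G` (`homogTrans_kill_eq`);
* restricting `hw` to the hyperplane `X_i = 0` (shifted by `-τ X_i`) transfers it to `G` (`homogTrans_restrict`);
* substituting `X ↦ X - X_i v + w S`, `S ↦ X_i` in `hv` and combining gives the claim (`homogTrans_extend`).
-/

noncomputable section

set_option linter.dupNamespace false

namespace Summit.ResolutionOfSingularities.ResolutionOfSingularities.Theorems.NarrowRunsDie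

open MvPolynomial

/-- Two substitutions that agree pointwise give the same `aeval`. -/
theorem homogTrans_aeval_congr {σ R S : Type*} [CommSemiring R] [CommSemiring S] [Algebra R S]
    {f g : σ → S} (Q : MvPolynomial σ R) (h : ∀ j, f j = g j) : aeval f Q = aeval g Q := by
  rw [show f = g from funext h]

/-- Substituting into `Q(X₁,…,0,…,Xₙ)` a vector whose `i`-th entry vanishes is substituting into `Q`. -/
theorem homogTrans_aeval_kill_of {σ R S : Type*} [CommSemiring R] [CommSemiring S] [Algebra R S]
    [DecidableEq σ] (i : σ) (F : σ → S) (hF : F i = 0) (Q : MvPolynomial σ R) :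
    aeval F (aeval (fun j => if j = i then (0 : MvPolynomial σ R) else X j) Q) = aeval F Q := by
  rw [comp_aeval_apply]
  exact homogTrans_aeval_congr Q fun j => by by_cases hj : j = i <;> simp [hj, hF]

/-- Evaluating `Q(X₁,…,0,…,Xₙ)` at a point with vanishing `i`-th coordinate is evaluating `Q`. -/
theorem homogTrans_eval_kill {σ R : Type*} [CommSemiring R] [DecidableEq σ] (i : σ) (u : σ → R)
    (hu : u i = 0) (Q : MvPolynomial σ R) :
    eval u (aeval (fun j => if j = i then (0 : MvPolynomial σ R) else X j) Q) = eval u Q :=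
  homogTrans_aeval_kill_of i u hu Q

/-- Transfer of a substitution with vanishing `i`-th entry along `kill Q' = kill Q`. -/
theorem homogTrans_transfer {σ R S : Type*} [CommSemiring R] [CommSemiring S] [Algebra R S]
    [DecidableEq σ] (i : σ) {Q Q' : MvPolynomial σ R}
    (h : aeval (fun j => if j = i then (0 : MvPolynomial σ R) else X j) Q' =
      aeval (fun j => if j = i then (0 : MvPolynomial σ R) else X j) Q)
    (F : σ → S) (hF : F i = 0) : aeval F Q' = aeval F Q := by
  rw [← homogTrans_aeval_kill_of i F hF Q', h, homogTrans_aeval_kill_of i F hF Q]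

/-- A multi-index of total degree `p > 0` all of whose entries are divisible by `p` is `p • e_k`. -/
theorem homogTrans_single_of_dvd {n p : ℕ} (hp : 0 < p) (A : Fin n →₀ ℕ)
    (hsum : Finset.sum Finset.univ (fun j => A j) = p) (hdvd : ∀ j, p ∣ A j) :
    ∃ k, A = Finsupp.single k p := by
  obtain ⟨k, hk⟩ : ∃ k, A k ≠ 0 := by
    by_contra h
    rw [Finset.sum_eq_zero (fun j _ => not_not.mp (not_exists.mp h j))] at hsum
    omega
  have hkp : A k = p := by
    apply le_antisymm
    · calc A k ≤ Finset.sum Finset.univ (fun j => A j) :=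
            Finset.single_le_sum (fun j _ => Nat.zero_le (A j)) (Finset.mem_univ k)
        _ = p := hsum
    · exact Nat.le_of_dvd (Nat.pos_of_ne_zero hk) (hdvd k)
  refine ⟨k, Finsupp.ext fun j => ?_⟩
  by_cases hj : j = k
  · rw [hj, Finsupp.single_eq_same, hkp]
  · rw [Finsupp.single_eq_of_ne hj]
    have h2 := Finset.add_sum_erase Finset.univ (fun j => A j) (Finset.mem_univ k)
    have h3 : Finset.sum (Finset.univ.erase k) (fun j => A j) = 0 := by omega
    exact Finset.sum_eq_zero_iff.mp h3 j (Finset.mem_erase.mpr ⟨hj, Finset.mem_univ j⟩)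

/-- From `hv` (substituting `X none ↦ 1`, `X (some i) ↦ 0`): `G(v + u') = G|_{X_i = 0} + G(v)`. -/
theorem homogTrans_g_eq {n : ℕ} {κ : Type} [Field κ] (p : ℕ) (G : MvPolynomial (Fin n) κ)
    (i : Fin n) (τ : Fin n → κ)
    (hv : MvPolynomial.aeval (fun j : Fin n => (MvPolynomial.X (some j) : MvPolynomial (Option (Fin n)) κ) + MvPolynomial.C (Function.update τ i 1 j) * MvPolynomial.X none) G
      = MvPolynomial.rename some G + MvPolynomial.C (MvPolynomial.eval (Function.update τ i 1) G) * (MvPolynomial.X none) ^ p) :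
    aeval (fun j : Fin n => if j = i then (1 : MvPolynomial (Fin n) κ) else X j + C (τ j)) G =
      aeval (fun j : Fin n => if j = i then (0 : MvPolynomial (Fin n) κ) else X j) G
        + C (eval (Function.update τ i 1) G) := by
  have E := congrArg (aeval (fun o : Option (Fin n) =>
    o.elim (1 : MvPolynomial (Fin n) κ) (fun j => if j = i then 0 else X j))) hv
  simp only [comp_aeval_apply, map_add, map_mul, map_pow, aeval_X, algHom_C, algebraMap_eq,
    Option.elim_none, Option.elim_some, aeval_rename, Function.comp_def, mul_one, one_pow] at E
  exact (homogTrans_aeval_congr G fun j => by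
    by_cases hj : j = i
    · subst hj; simp
    · simp [hj]).trans E

/-- Step A: the successor cone and the cone agree off the exceptional variable `X i`. -/
theorem homogTrans_kill_eq {n : ℕ} {κ : Type} [Field κ] {p : ℕ} (hp : p.Prime)
    (G G' : MvPolynomial (Fin n) κ) (i : Fin n) (τ : Fin n → κ)
    (hG : G.IsHomogeneous p) (hG' : G'.IsHomogeneous p)
    (hdiag : ∀ j : Fin n, MvPolynomial.coeff (Finsupp.single j p) G = 0)
    (hg : aeval (fun j : Fin n => if j = i then (1 : MvPolynomial (Fin n) κ) else X j + C (τ j)) G =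
      aeval (fun j : Fin n => if j = i then (0 : MvPolynomial (Fin n) κ) else X j) G
        + C (eval (Function.update τ i 1) G))
    (hslice : ∀ A : Fin n →₀ ℕ, A i = 0 → Finset.sum Finset.univ (fun j => A j) = p →
      MvPolynomial.coeff A G' = @ite κ (∀ j, p ∣ A j) (Classical.dec _) 0
        (MvPolynomial.coeff A (MvPolynomial.aeval (fun j : Fin n => if j = i then (1 : MvPolynomial (Fin n) κ) else MvPolynomial.X j + MvPolynomial.C (τ j)) G))) :
    aeval (fun j : Fin n => if j = i then (0 : MvPolynomial (Fin n) κ) else X j) G' =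
      aeval (fun j : Fin n => if j = i then (0 : MvPolynomial (Fin n) κ) else X j) G := by
  refine MvPolynomial.ext _ _ fun A => ?_
  rw [homogNear_coeff_kill, homogNear_coeff_kill]
  by_cases hAi : A i = 0
  · rw [if_pos hAi, if_pos hAi]
    by_cases hsum : Finset.sum Finset.univ (fun j => A j) = p
    · rw [hslice A hAi hsum]
      split_ifs with hdvd
      · obtain ⟨k, hk⟩ := homogTrans_single_of_dvd hp.pos A hsum hdvd
        rw [hk, hdiag]
      · rw [hg, coeff_add, homogNear_coeff_kill, if_pos hAi, coeff_C, if_neg, add_zero]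
        rintro rfl
        simp only [Finsupp.coe_zero, Pi.zero_apply, Finset.sum_const_zero] at hsum
        exact hp.ne_zero hsum.symm
    · have hdeg : A.degree ≠ p := by rwa [Finsupp.degree_eq_sum]
      rw [hG.coeff_eq_zero hdeg, hG'.coeff_eq_zero hdeg]
  · rw [if_neg hAi, if_neg hAi]

/-- Step B: restrict `hw` to the hyperplane `X_i = 0` (sheared by `-τ·X_i`) and move it to `G`. -/
theorem homogTrans_restrict {n : ℕ} {κ : Type} [Field κ] (p : ℕ) (G G' : MvPolynomial (Fin n) κ)
    (i : Fin n) (τ w : Fin n → κ) (hwi : w i = 0)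
    (hkill : aeval (fun j : Fin n => if j = i then (0 : MvPolynomial (Fin n) κ) else X j) G' =
      aeval (fun j : Fin n => if j = i then (0 : MvPolynomial (Fin n) κ) else X j) G)
    (hw : MvPolynomial.aeval (fun j : Fin n => (MvPolynomial.X (some j) : MvPolynomial (Option (Fin n)) κ) + MvPolynomial.C (w j) * MvPolynomial.X none) G'
      = MvPolynomial.rename some G' + MvPolynomial.C (MvPolynomial.eval (w) G') * (MvPolynomial.X none) ^ p) :
    aeval (fun j : Fin n => if j = i then (0 : MvPolynomial (Option (Fin n)) κ)
        else X (some j) - C (τ j) * X (some i) + C (w j) * X none) G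
      = aeval (fun j : Fin n => if j = i then (0 : MvPolynomial (Option (Fin n)) κ)
          else X (some j) - C (τ j) * X (some i)) G + C (eval w G) * (X none) ^ p := by
  have E := congrArg (aeval (fun o : Option (Fin n) =>
    o.elim (X none : MvPolynomial (Option (Fin n)) κ)
      (fun j => if j = i then 0 else X (some j) - C (τ j) * X (some i)))) hw
  simp only [comp_aeval_apply, map_add, map_mul, map_pow, aeval_X, algHom_C, algebraMap_eq,
    Option.elim_none, Option.elim_some, aeval_rename, Function.comp_def] at E
  rw [← homogTrans_transfer i hkill (fun j : Fin n => if j = i then (0 : MvPolynomial (Option (Fin n)) κ)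
        else X (some j) - C (τ j) * X (some i) + C (w j) * X none) (by simp),
    ← homogTrans_transfer i hkill (fun j : Fin n => if j = i then (0 : MvPolynomial (Option (Fin n)) κ)
        else X (some j) - C (τ j) * X (some i)) (by simp),
    ← homogTrans_eval_kill i w hwi G, ← hkill, homogTrans_eval_kill i w hwi G']
  exact (homogTrans_aeval_congr G' fun j => by
    by_cases hj : j = i
    · subst hj; simp [hwi]
    · simp [hj]).trans E

/-- Step C: extend from the hyperplane using `hv` (substitute `X ↦ X - X_i v + w S`, `S ↦ X_i`). -/
theorem homogTrans_extend {n : ℕ} {κ : Type} [Field κ] (p : ℕ) (G : MvPolynomial (Fin n) κ)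
    (i : Fin n) (τ w : Fin n → κ) (hwi : w i = 0)
    (hv : MvPolynomial.aeval (fun j : Fin n => (MvPolynomial.X (some j) : MvPolynomial (Option (Fin n)) κ) + MvPolynomial.C (Function.update τ i 1 j) * MvPolynomial.X none) G
      = MvPolynomial.rename some G + MvPolynomial.C (MvPolynomial.eval (Function.update τ i 1) G) * (MvPolynomial.X none) ^ p)
    (hH : aeval (fun j : Fin n => if j = i then (0 : MvPolynomial (Option (Fin n)) κ)
        else X (some j) - C (τ j) * X (some i) + C (w j) * X none) G
      = aeval (fun j : Fin n => if j = i then (0 : MvPolynomial (Option (Fin n)) κ)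
          else X (some j) - C (τ j) * X (some i)) G + C (eval w G) * (X none) ^ p) :
    MvPolynomial.aeval (fun j : Fin n => (MvPolynomial.X (some j) : MvPolynomial (Option (Fin n)) κ) + MvPolynomial.C (w j) * MvPolynomial.X none) G
      = MvPolynomial.rename some G + MvPolynomial.C (MvPolynomial.eval (w) G) * (MvPolynomial.X none) ^ p := by
  -- `θ` applied to `hv`
  have E2 := congrArg (aeval (fun o : Option (Fin n) =>
    o.elim (X (some i) : MvPolynomial (Option (Fin n)) κ)
      (fun j => if j = i then 0 else X (some j) - C (τ j) * X (some i) + C (w j) * X none))) hv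
  simp only [comp_aeval_apply, map_add, map_mul, map_pow, aeval_X, algHom_C, algebraMap_eq,
    Option.elim_none, Option.elim_some, aeval_rename, Function.comp_def] at E2
  have E2' : aeval (fun j : Fin n => (X (some j) : MvPolynomial (Option (Fin n)) κ) + C (w j) * X none) G
      = aeval (fun j : Fin n => if j = i then (0 : MvPolynomial (Option (Fin n)) κ)
          else X (some j) - C (τ j) * X (some i) + C (w j) * X none) G
        + C (eval (Function.update τ i 1) G) * X (some i) ^ p :=
    (homogTrans_aeval_congr G fun j => by
      by_cases hj : j = i
      · subst hj; simp [hwi]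
      · simp only [if_neg hj, Function.update_of_ne hj]; ring).trans E2
  -- `θ₀` applied to `hv`
  have E3 := congrArg (aeval (fun o : Option (Fin n) =>
    o.elim (X (some i) : MvPolynomial (Option (Fin n)) κ)
      (fun j => if j = i then 0 else X (some j) - C (τ j) * X (some i)))) hv
  simp only [comp_aeval_apply, map_add, map_mul, map_pow, aeval_X, algHom_C, algebraMap_eq,
    Option.elim_none, Option.elim_some, aeval_rename, Function.comp_def] at E3
  have E3' : aeval (X ∘ some : Fin n → MvPolynomial (Option (Fin n)) κ) G
      = aeval (fun j : Fin n => if j = i then (0 : MvPolynomial (Option (Fin n)) κ)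
          else X (some j) - C (τ j) * X (some i)) G
        + C (eval (Function.update τ i 1) G) * X (some i) ^ p :=
    (homogTrans_aeval_congr G fun j => by
      by_cases hj : j = i
      · subst hj; simp
      · simp only [Function.comp_apply, if_neg hj, Function.update_of_ne hj]; ring).trans E3
  rw [E2', hH, rename_eq_aeval, E3']
  ring

/-- The registered stub statement `Sig.stub_homogTrans` of line `derivlift`, VERBATIM the skeleton's
`Sig.stub_homogTrans` (`Cruxes/NarrowRunsDie/Lines/derivlift.lean`; restated because `Theorems/` does not
import `Cruxes/` — the two definitions unfold to the same term, so the skeleton's stub is closed by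
`exact Theorems.NarrowRunsDie.stub_homogTrans`). -/
def Sig.stub_homogTrans : Prop :=
  ∀ p : ℕ, p.Prime → ∀ (n : ℕ) (κ : Type) [Field κ] [CharP κ p]
    (G G' : MvPolynomial (Fin n) κ) (i : Fin n) (τ w : Fin n → κ),
    G.IsHomogeneous p → G'.IsHomogeneous p →
    (∀ j : Fin n, MvPolynomial.coeff (Finsupp.single j p) G = 0) →
    w i = 0 →
    MvPolynomial.aeval (fun j : Fin n => (MvPolynomial.X (some j) : MvPolynomial (Option (Fin n)) κ) + MvPolynomial.C (Function.update τ i 1 j) * MvPolynomial.X none) G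
      = MvPolynomial.rename some G + MvPolynomial.C (MvPolynomial.eval (Function.update τ i 1) G) * (MvPolynomial.X none) ^ p →
    (∀ A : Fin n →₀ ℕ, A i = 0 → Finset.sum Finset.univ (fun j => A j) = p →
      MvPolynomial.coeff A G' = @ite κ (∀ j, p ∣ A j) (Classical.dec _) 0
        (MvPolynomial.coeff A (MvPolynomial.aeval (fun j : Fin n => if j = i then (1 : MvPolynomial (Fin n) κ) else MvPolynomial.X j + MvPolynomial.C (τ j)) G))) →
    MvPolynomial.aeval (fun j : Fin n => (MvPolynomial.X (some j) : MvPolynomial (Option (Fin n)) κ) + MvPolynomial.C (w j) * MvPolynomial.X none) G'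
      = MvPolynomial.rename some G' + MvPolynomial.C (MvPolynomial.eval (w) G') * (MvPolynomial.X none) ^ p →
    MvPolynomial.aeval (fun j : Fin n => (MvPolynomial.X (some j) : MvPolynomial (Option (Fin n)) κ) + MvPolynomial.C (w j) * MvPolynomial.X none) G
      = MvPolynomial.rename some G + MvPolynomial.C (MvPolynomial.eval (w) G) * (MvPolynomial.X none) ^ p

/-- Stub `stub_homogTrans` of line `derivlift` for crux `WildCones.NarrowRunsDie`, unfolded statement:
an invariance direction `w` of the successor cone `G'` lying in the exceptional hyperplane `w i = 0`
is already an invariance direction of the cone `G` ("`L(G|_H) = L(G) ∩ H`"). -/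
theorem homogTrans_main :
  ∀ p : ℕ, p.Prime → ∀ (n : ℕ) (κ : Type) [Field κ] [CharP κ p]
    (G G' : MvPolynomial (Fin n) κ) (i : Fin n) (τ w : Fin n → κ),
    G.IsHomogeneous p → G'.IsHomogeneous p →
    (∀ j : Fin n, MvPolynomial.coeff (Finsupp.single j p) G = 0) →
    w i = 0 →
    MvPolynomial.aeval (fun j : Fin n => (MvPolynomial.X (some j) : MvPolynomial (Option (Fin n)) κ) + MvPolynomial.C (Function.update τ i 1 j) * MvPolynomial.X none) G
      = MvPolynomial.rename some G + MvPolynomial.C (MvPolynomial.eval (Function.update τ i 1) G) * (MvPolynomial.X none) ^ p →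
    (∀ A : Fin n →₀ ℕ, A i = 0 → Finset.sum Finset.univ (fun j => A j) = p →
      MvPolynomial.coeff A G' = @ite κ (∀ j, p ∣ A j) (Classical.dec _) 0
        (MvPolynomial.coeff A (MvPolynomial.aeval (fun j : Fin n => if j = i then (1 : MvPolynomial (Fin n) κ) else MvPolynomial.X j + MvPolynomial.C (τ j)) G))) →
    MvPolynomial.aeval (fun j : Fin n => (MvPolynomial.X (some j) : MvPolynomial (Option (Fin n)) κ) + MvPolynomial.C (w j) * MvPolynomial.X none) G'
      = MvPolynomial.rename some G' + MvPolynomial.C (MvPolynomial.eval (w) G') * (MvPolynomial.X none) ^ p →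
    MvPolynomial.aeval (fun j : Fin n => (MvPolynomial.X (some j) : MvPolynomial (Option (Fin n)) κ) + MvPolynomial.C (w j) * MvPolynomial.X none) G
      = MvPolynomial.rename some G + MvPolynomial.C (MvPolynomial.eval (w) G) * (MvPolynomial.X none) ^ p := by
  intro p hp n κ _ _ G G' i τ w hG hG' hdiag hwi hv hslice hw
  have hg := homogTrans_g_eq p G i τ hv
  have hkill := homogTrans_kill_eq hp G G' i τ hG hG' hdiag hg hslice
  have hH := homogTrans_restrict p G G' i τ w hwi hkill hw
  exact homogTrans_extend p G i τ w hwi hv hH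

/-- Stub `stub_homogTrans` of line `derivlift` for crux `WildCones.NarrowRunsDie` (registered signature
`Sig.stub_homogTrans`, verbatim). -/
theorem stub_homogTrans : Sig.stub_homogTrans :=
  homogTrans_main

end Summit.ResolutionOfSingularities.ResolutionOfSingularities.Theorems.NarrowRunsDie

end
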